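/-
Copyright (c) 2026 the pub-hodgecm-mathlib formalisation cell (harness21).  Prover seat hodgecm-mathlib-K2E4-p11 (g6), Track B ∕ K2-LIT, h413 = `stmt-HodgeConjecture-24833`,
line `K2_E1_TraceFormulaBeta`, campaign «5Res ENDGAME BY FAMILIES», ROADCARD §3′ (M2 v2) item D1′, ED. 2 (companion of ★ p860075 ∕ ★ p860106, own block per K2-lead R34 (ii)): from
indicators to every BOUNDED `σ(S)`-measurable multiplier.  Mathlib only.
-/
import Summits.HodgeConjecture.HodgeConjecture.Theorems.K2E1CommutantOfMultiplicationFamily   -- ★ D1′-B p860106 (this seat): Dynkin step, σ(S) head, `re`∕`im`; brings ★ D1′-A p860075 (bounded-limit closure, products, constants)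
import HarnessLib

/-!
# D1′ ED. 2 — `K2E1CommutantOfMultiplicationFamilyBounded`: `Q M_s = M_s Q` (`s ∈ S`) ⟹ `Q M_g = M_g Q` for every BOUNDED `σ(S)`-MEASURABLE `g` (real, then complex) — the literal
# conclusion of ROADCARD §3′ item D1′ (Mathlib only, over ★ D1′-A∕B)

Track B ∕ K2-LIT, crux h413 = `stmt-HodgeConjecture-24833`, route of record `HCCMUnconditional`; cell `hodgecm-mathlib`, squad K2, ENGINE E1; ROADCARD §3′
`K2/K2E1-plan/g7/ROADCARD-5Res-FAMILIES-M2v2.K2E1-plan-g7.md` item D1′ («… ⟹ `Q ∘ M_g = M_g ∘ Q` for every bounded σ(S)-measurable g»; used by D4′a «from `{k̂}` to all bounded Borel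
`g`» and (228)(iii′)).  THEOREMS ONLY (no `def`, no `instance`, no `notation`, no `sorry`; default heartbeats); lane `--supports stmt-HodgeConjecture-24833 --as helper` (count-neutral).
Currency and ELABORATION NOTE as ★ D1′-A (local instance binder `[ENNReal.HolderTriple ∞ 2 2]`).

THE MATHEMATICS ([Rudin1991, Thm 12.22, §12.24]; [ReedSimonI1980, §VII.2–VII.3]).  ★ D1′-B: `Q` commutes with `M_{𝟙_A}` for all `A ∈ σ(S)`.  LAYER CAKE (§1): a bounded real `g`
(`|g| ≤ K`) all of whose sub-level indicators `𝟙_{g<c}` commute with `Q` is the bounded pointwise limit of the step functions `g_N = Σ_{j<J_N} a_j·𝟙_{a_j ≤ g < a_{j+1}}`,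
`a_j = −K + j∕(N+1)`, `J_N = ⌊2K(N+1)⌋ + 1` (`|g_N − g| < 1∕(N+1)`, `|g_N| ≤ K`), each a finite sum of scalar multiples of products `𝟙_{g<a_{j+1}}·𝟙_{(g<a_j)ᶜ}` of commuting indicators —
so `M_g` commutes with `Q` (★ D1′-A `commute_toLp_of_tendsto`).  §2: hence every bounded `σ(S)`-measurable real `g` (its sub-level sets lie in `σ(S)`); §3: every bounded complex `g`
whose real and imaginary parts are `σ(S)`-measurable (`g = re g + i·im g`).
* §1 `commute_lpSMul_finset_sum`, `commute_indicator_slab`, `layerCake_apply` (`g_N(x) = a_{⌊(g(x)+K)(N+1)⌋}`), **`commute_toLp_of_forall_indicator_lt`**.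
* §2 HEAD **`commute_toLp_of_measurable_sigma`** (real).   §3 **`commute_toLp_of_measurable_sigma_re_im`** (complex, via `re`∕`im`).
HONEST LABEL: HC_CM is proved only modulo the 7 printed citations (2 remaining named inputs: hLiu418 = `stmt-HodgeConjecture-24832`, h413 = `stmt-HodgeConjecture-24833`) until rung 0
closes; this file asserts no named fact, closes no socket; count-neutral; letter-free, Mathlib-only over ★ D1′-A∕B.

## References
* [Rudin1991] W. Rudin, *Functional Analysis* (2nd ed., 1991), Thm 12.22, §12.24.
* [ReedSimonI1980] M. Reed, B. Simon, *Methods of Modern Mathematical Physics I: Functional Analysis* (rev. ed. 1980), §VII.2–VII.3.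
-/

set_option autoImplicit false
set_option linter.dupNamespace false  -- the mandated namespace repeats the summit's segment (`HodgeConjecture.HodgeConjecture`)

noncomputable section

open MeasureTheory Set Filter Topology MeasurableSpace
open scoped ENNReal
open Summit.HodgeConjecture.HodgeConjecture.Cruxes.H413.K2E1LinftyCommutantCalculusL2
open Summit.HodgeConjecture.HodgeConjecture.Cruxes.H413.K2E1CommutantOfMultiplicationFamily

namespace Summit.HodgeConjecture.HodgeConjecture.Cruxes.H413.K2E1CommutantOfMultiplicationFamilyBounded

variable {Ω : Type*} [MeasurableSpace Ω] {m : Measure Ω} {𝕜 : Type*} [RCLike 𝕜] {E : Type*} [NormedAddCommGroup E] [NormedSpace 𝕜 E]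
variable [ENNReal.HolderTriple ∞ 2 2]

/-! ## §1 Layer cake: from the sub-level indicators of a bounded real `g` to `g` itself -/

section LayerCake

variable (Q : Lp E 2 m →L[𝕜] Lp E 2 m)

/-- Finite sums of commuting bounded multipliers (given as functions with `L∞` witnesses) commute. [cite: Rudin1991, Thm 12.22] -/
theorem commute_toLp_finset_sum {ι : Type*} (s : Finset ι) (φ : ι → Ω → 𝕜) (hφ : ∀ i, MemLp (φ i) ∞ m)
    (hQ : ∀ i, ∀ f : Lp E 2 m, Q ((hφ i).toLp (φ i) • f) = (hφ i).toLp (φ i) • Q f)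
    (h : MemLp (fun x => ∑ i ∈ s, φ i x) ∞ m) (f : Lp E 2 m) :
    Q (h.toLp (fun x => ∑ i ∈ s, φ i x) • f) = h.toLp (fun x => ∑ i ∈ s, φ i x) • Q f := by
  classical
  induction s using Finset.induction_on generalizing f with
  | empty =>
    have h0 : h.toLp (fun x => ∑ i ∈ (∅ : Finset ι), φ i x) = (MemLp.zero : MemLp (0 : Ω → 𝕜) ∞ m).toLp (0 : Ω → 𝕜) :=
      MemLp.toLp_congr _ _ (Eventually.of_forall fun x => by simp only [Finset.sum_empty, Pi.zero_apply])
    rw [h0, MemLp.toLp_zero, Lp.zero_smul, map_zero, Lp.zero_smul]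
  | @insert i s hi ih =>
    have hs : MemLp (fun x => ∑ j ∈ s, φ j x) ∞ m := memLp_finsetSum s fun j _ => hφ j
    have heq : h.toLp (fun x => ∑ j ∈ insert i s, φ j x) = ((hφ i).add hs).toLp (φ i + fun x => ∑ j ∈ s, φ j x) :=
      MemLp.toLp_congr _ _ (Eventually.of_forall fun x => by
        show (∑ j ∈ insert i s, φ j x) = φ i x + ∑ j ∈ s, φ j x
        rw [Finset.sum_insert hi])
    rw [heq]
    exact commute_toLp_add Q (hφ i) hs (hQ i) (ih hs) f

/-- **Slab indicators commute**: `𝟙_{a ≤ g < b} = 𝟙_{g<b}·𝟙_{(g<a)ᶜ}`. [cite: Rudin1991, Thm 12.22] -/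
theorem commute_indicator_slab {g : Ω → ℝ} (hgm : Measurable g)
    (hQg : ∀ c : ℝ, ∀ (h : MemLp ({x | g x < c}.indicator fun _ : Ω => (1 : 𝕜)) ∞ m) (f : Lp E 2 m),
      Q (h.toLp ({x | g x < c}.indicator fun _ : Ω => (1 : 𝕜)) • f) = h.toLp ({x | g x < c}.indicator fun _ : Ω => (1 : 𝕜)) • Q f)
    (a b : ℝ) (h : MemLp (({x | g x < b} ∩ {x | g x < a}ᶜ).indicator fun _ : Ω => (1 : 𝕜)) ∞ m) (f : Lp E 2 m) :
    Q (h.toLp (({x | g x < b} ∩ {x | g x < a}ᶜ).indicator fun _ : Ω => (1 : 𝕜)) • f) = h.toLp (({x | g x < b} ∩ {x | g x < a}ᶜ).indicator fun _ : Ω => (1 : 𝕜)) • Q f := by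
  have hb : MeasurableSet {x | g x < b} := measurableSet_lt hgm measurable_const
  have ha : MeasurableSet {x | g x < a} := measurableSet_lt hgm measurable_const
  exact commute_indicator_inter Q hb ha.compl (hQg b _) (commute_indicator_compl Q ha (hQg a _) _) h f

omit [MeasurableSpace Ω] [ENNReal.HolderTriple ∞ 2 2] in
/-- **The layer-cake step function evaluates to the lower grid point**: for `|g x| ≤ K`, with `a_j = −K + j∕(N+1)` and `j₀ = ⌊(g x + K)(N+1)⌋`,
`Σ_{j < ⌊2K(N+1)⌋+1} a_j·𝟙_{a_j ≤ g < a_{j+1}}(x) = a_{j₀}`, and `0 ≤ g x − a_{j₀} < 1∕(N+1)`. [folklore] -/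
theorem layerCake_apply {g : Ω → ℝ} {K : ℝ} (hK : ∀ x, |g x| ≤ K) (N : ℕ) (x : Ω) :
    (∑ j ∈ Finset.range (⌊2 * K * ((N : ℝ) + 1)⌋₊ + 1),
        ((-K + (j : ℝ) / ((N : ℝ) + 1) : ℝ) : 𝕜) *
          ({y | g y < -K + ((j : ℝ) + 1) / ((N : ℝ) + 1)} ∩ {y | g y < -K + (j : ℝ) / ((N : ℝ) + 1)}ᶜ).indicator (fun _ : Ω => (1 : 𝕜)) x) =
      ((-K + (⌊(g x + K) * ((N : ℝ) + 1)⌋₊ : ℝ) / ((N : ℝ) + 1) : ℝ) : 𝕜) ∧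
    0 ≤ g x - (-K + (⌊(g x + K) * ((N : ℝ) + 1)⌋₊ : ℝ) / ((N : ℝ) + 1)) ∧
    g x - (-K + (⌊(g x + K) * ((N : ℝ) + 1)⌋₊ : ℝ) / ((N : ℝ) + 1)) < 1 / ((N : ℝ) + 1) := by
  have hN : (0 : ℝ) < (N : ℝ) + 1 := Nat.cast_add_one_pos N
  have hgK : 0 ≤ (g x + K) * ((N : ℝ) + 1) := mul_nonneg (by linarith [neg_le_of_abs_le (hK x)]) hN.le
  set j₀ : ℕ := ⌊(g x + K) * ((N : ℝ) + 1)⌋₊ with hj₀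
  have h1 : (j₀ : ℝ) ≤ (g x + K) * ((N : ℝ) + 1) := Nat.floor_le hgK
  have h2 : (g x + K) * ((N : ℝ) + 1) < (j₀ : ℝ) + 1 := Nat.lt_floor_add_one _
  -- membership: `x ∈ A_j ↔ j = j₀`
  have hmem : ∀ j : ℕ, x ∈ ({y | g y < -K + ((j : ℝ) + 1) / ((N : ℝ) + 1)} ∩ {y | g y < -K + (j : ℝ) / ((N : ℝ) + 1)}ᶜ) ↔ j = j₀ := by
    intro j
    simp only [Set.mem_inter_iff, Set.mem_setOf_eq, Set.mem_compl_iff, not_lt]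
    constructor
    · rintro ⟨hlt, hle⟩
      symm
      rw [hj₀, Nat.floor_eq_iff hgK]
      constructor
      · exact (div_le_iff₀ hN).1 (by linarith)
      · exact (lt_div_iff₀ hN).1 (by linarith)
    · rintro rfl
      have h3 : g x + K < ((j₀ : ℝ) + 1) / ((N : ℝ) + 1) := (lt_div_iff₀ hN).2 h2
      have h4 : (j₀ : ℝ) / ((N : ℝ) + 1) ≤ g x + K := (div_le_iff₀ hN).2 h1
      constructor
      · linarith
      · linarith
  have hj₀J : j₀ ∈ Finset.range (⌊2 * K * ((N : ℝ) + 1)⌋₊ + 1) := by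
    rw [Finset.mem_range, Nat.lt_add_one_iff]
    refine Nat.floor_le_floor ?_
    have := le_of_abs_le (hK x)
    nlinarith
  have h3 : g x + K < ((j₀ : ℝ) + 1) / ((N : ℝ) + 1) := (lt_div_iff₀ hN).2 h2
  have h4 : (j₀ : ℝ) / ((N : ℝ) + 1) ≤ g x + K := (div_le_iff₀ hN).2 h1
  rw [add_div] at h3
  refine ⟨?_, by linarith, by linarith⟩
  rw [Finset.sum_eq_single_of_mem j₀ hj₀J fun j _ hj => ?_]
  · rw [Set.indicator_of_mem ((hmem j₀).2 rfl), mul_one]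
  · rw [Set.indicator_of_notMem (fun hx => hj ((hmem j).1 hx)), mul_zero]

/-- **LAYER CAKE: if every sub-level indicator `𝟙_{g<c}` of a bounded measurable real `g` commutes with `Q`, so does `M_g`.**  (`g_N → g` boundedly, each `g_N` a finite sum of
scalar multiples of slab indicators; ★ D1′-A `commute_toLp_of_tendsto`.) [cite: Rudin1991, Thm 12.22, §12.24] [cite: ReedSimonI1980, §VII.3] -/
theorem commute_toLp_of_forall_indicator_lt {g : Ω → ℝ} (hgm : Measurable g) {K : ℝ} (hK : ∀ x, |g x| ≤ K)
    (hQg : ∀ c : ℝ, ∀ (h : MemLp ({x | g x < c}.indicator fun _ : Ω => (1 : 𝕜)) ∞ m) (f : Lp E 2 m),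
      Q (h.toLp ({x | g x < c}.indicator fun _ : Ω => (1 : 𝕜)) • f) = h.toLp ({x | g x < c}.indicator fun _ : Ω => (1 : 𝕜)) • Q f)
    (h : MemLp (fun x => ((g x : ℝ) : 𝕜)) ∞ m) (f : Lp E 2 m) :
    Q (h.toLp (fun x => ((g x : ℝ) : 𝕜)) • f) = h.toLp (fun x => ((g x : ℝ) : 𝕜)) • Q f := by
  -- the slab indicators and the step functions
  have hslabm : ∀ (N j : ℕ), MeasurableSet ({y | g y < -K + ((j : ℝ) + 1) / ((N : ℝ) + 1)} ∩ {y | g y < -K + (j : ℝ) / ((N : ℝ) + 1)}ᶜ) := fun N j =>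
    (measurableSet_lt hgm measurable_const).inter (measurableSet_lt hgm measurable_const).compl
  have hterm : ∀ (N j : ℕ), MemLp (fun x => ((-K + (j : ℝ) / ((N : ℝ) + 1) : ℝ) : 𝕜) *
      ({y | g y < -K + ((j : ℝ) + 1) / ((N : ℝ) + 1)} ∩ {y | g y < -K + (j : ℝ) / ((N : ℝ) + 1)}ᶜ).indicator (fun _ : Ω => (1 : 𝕜)) x) ∞ m := fun N j =>
    (memLp_top_indicator (hslabm N j)).const_mul _
  have hQterm : ∀ (N j : ℕ) (f : Lp E 2 m), Q ((hterm N j).toLp _ • f) = (hterm N j).toLp _ • Q f := by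
    intro N j f
    have heq : (hterm N j).toLp _ = (((-K + (j : ℝ) / ((N : ℝ) + 1) : ℝ) : 𝕜)) • (memLp_top_indicator (𝕜 := 𝕜) (m := m) (hslabm N j)).toLp _ := by
      rw [← MemLp.toLp_const_smul]
      exact MemLp.toLp_congr _ _ (Eventually.of_forall fun x => by rw [Pi.smul_apply, smul_eq_mul])
    rw [heq]
    exact commute_lpSMul_const_smul Q _ (commute_indicator_slab Q hgm hQg _ _ _) f
  have hstep : ∀ N : ℕ, MemLp (fun x => ∑ j ∈ Finset.range (⌊2 * K * ((N : ℝ) + 1)⌋₊ + 1), ((-K + (j : ℝ) / ((N : ℝ) + 1) : ℝ) : 𝕜) *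
      ({y | g y < -K + ((j : ℝ) + 1) / ((N : ℝ) + 1)} ∩ {y | g y < -K + (j : ℝ) / ((N : ℝ) + 1)}ᶜ).indicator (fun _ : Ω => (1 : 𝕜)) x) ∞ m := fun N =>
    memLp_finsetSum _ fun j _ => hterm N j
  refine commute_toLp_of_tendsto Q (K := K) hstep h (fun N x => ?_) (fun x => ?_) (fun N => commute_toLp_finset_sum Q _ _ (hterm N) (hQterm N) (hstep N)) f
  · -- bound `|g_N x| ≤ K`
    obtain ⟨hval, h0, h1⟩ := layerCake_apply (𝕜 := 𝕜) hK N x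
    rw [hval, RCLike.norm_ofReal]
    have hKx := hK x
    rw [abs_le] at hKx ⊢
    have hN : (0 : ℝ) < (N : ℝ) + 1 := Nat.cast_add_one_pos N
    constructor
    · have : (0 : ℝ) ≤ (⌊(g x + K) * ((N : ℝ) + 1)⌋₊ : ℝ) / ((N : ℝ) + 1) := by positivity
      linarith
    · linarith [hKx.2]
  · -- convergence `g_N x → g x`
    have hlim : Tendsto (fun N : ℕ => (-K + (⌊(g x + K) * ((N : ℝ) + 1)⌋₊ : ℝ) / ((N : ℝ) + 1))) atTop (𝓝 (g x)) := by
      have h1 : Tendsto (fun N : ℕ => g x - (-K + (⌊(g x + K) * ((N : ℝ) + 1)⌋₊ : ℝ) / ((N : ℝ) + 1))) atTop (𝓝 0) :=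
        squeeze_zero (fun N => (layerCake_apply (𝕜 := 𝕜) hK N x).2.1) (fun N => (layerCake_apply (𝕜 := 𝕜) hK N x).2.2.le) tendsto_one_div_add_atTop_nhds_zero_nat
      have h2 := (tendsto_const_nhds (x := g x)).sub h1
      rw [sub_zero] at h2
      exact h2.congr fun N => by ring
    have h3 := ((RCLike.continuous_ofReal (K := 𝕜)).tendsto _).comp hlim
    refine h3.congr fun N => ?_
    exact ((layerCake_apply (𝕜 := 𝕜) hK N x).1).symm

end LayerCake

/-! ## §2 HEAD: every bounded `σ(S)`-measurable real multiplier -/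

section Head

variable (Q : Lp E 2 m →L[𝕜] Lp E 2 m)

/-- **HEAD (D1′, literal form).**  `S` a family of bounded measurable REAL multipliers with which the bounded operator `Q` on `L²(Ω; E)` commutes; `g` a BOUNDED real function MEASURABLE
for `σ(S)`.  THEN `Q M_g = M_g Q`.  (Sub-level sets of `g` lie in `σ(S)`, so their indicators commute by ★ D1′-B; layer cake §1.) [cite: Rudin1991, Thm 12.22, §12.24]
[cite: ReedSimonI1980, §VII.3] -/
theorem commute_toLp_of_measurable_sigma {S : Set (Ω → ℝ)} (hSm : ∀ s ∈ S, Measurable s) (hSb : ∀ s ∈ S, ∃ K : ℝ, ∀ x, |s x| ≤ K)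
    (hQS : ∀ s ∈ S, ∀ (hs : MemLp (fun x => ((s x : ℝ) : 𝕜)) ∞ m) (f : Lp E 2 m),
      Q (hs.toLp (fun x => ((s x : ℝ) : 𝕜)) • f) = hs.toLp (fun x => ((s x : ℝ) : 𝕜)) • Q f)
    {g : Ω → ℝ} (hg : Measurable[generateFrom {B : Set Ω | ∃ s ∈ S, ∃ c : ℝ, B = {x | s x < c}}] g) {K : ℝ} (hK : ∀ x, |g x| ≤ K)
    (h : MemLp (fun x => ((g x : ℝ) : 𝕜)) ∞ m) (f : Lp E 2 m) :
    Q (h.toLp (fun x => ((g x : ℝ) : 𝕜)) • f) = h.toLp (fun x => ((g x : ℝ) : 𝕜)) • Q f := by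
  have hgm : Measurable g := hg.mono (generateFrom_sublevel_le hSm) le_rfl
  refine commute_toLp_of_forall_indicator_lt Q hgm hK (fun c h' f' => ?_) h f
  exact commute_indicator_of_measurableSet_sigma Q hSm hSb hQS (hg measurableSet_Iio) h' f'

end Head

/-! ## §3 Bounded complex multipliers with `σ(S)`-measurable real and imaginary parts -/

section Complex

variable (Q : Lp E 2 m →L[𝕜] Lp E 2 m)

/-- **HEAD, complex form**: a bounded `g : Ω → 𝕜` whose real and imaginary parts are `σ(S)`-measurable commutes with `Q` (`g = re g + i·im g`). [cite: Rudin1991, Thm 12.22, §12.24] -/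
theorem commute_toLp_of_measurable_sigma_re_im {S : Set (Ω → ℝ)} (hSm : ∀ s ∈ S, Measurable s) (hSb : ∀ s ∈ S, ∃ K : ℝ, ∀ x, |s x| ≤ K)
    (hQS : ∀ s ∈ S, ∀ (hs : MemLp (fun x => ((s x : ℝ) : 𝕜)) ∞ m) (f : Lp E 2 m),
      Q (hs.toLp (fun x => ((s x : ℝ) : 𝕜)) • f) = hs.toLp (fun x => ((s x : ℝ) : 𝕜)) • Q f)
    {g : Ω → 𝕜} (hre : Measurable[generateFrom {B : Set Ω | ∃ s ∈ S, ∃ c : ℝ, B = {x | s x < c}}] fun x => RCLike.re (g x))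
    (him : Measurable[generateFrom {B : Set Ω | ∃ s ∈ S, ∃ c : ℝ, B = {x | s x < c}}] fun x => RCLike.im (g x))
    {K : ℝ} (hK : ∀ x, ‖g x‖ ≤ K) (h : MemLp g ∞ m) (f : Lp E 2 m) :
    Q (h.toLp g • f) = h.toLp g • Q f := by
  have hre' : MemLp (fun x => ((RCLike.re (g x) : ℝ) : 𝕜)) ∞ m := memLp_top_re h
  have him' : MemLp (fun x => ((RCLike.im (g x) : ℝ) : 𝕜)) ∞ m := memLp_top_im h
  have himI : MemLp (fun x => ((RCLike.im (g x) : ℝ) : 𝕜) * RCLike.I) ∞ m := him'.mul_const _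
  have hQre := commute_toLp_of_measurable_sigma Q hSm hSb hQS hre (K := K) (fun x => (RCLike.abs_re_le_norm (g x)).trans (hK x)) hre'
  have hQim := commute_toLp_of_measurable_sigma Q hSm hSb hQS him (K := K) (fun x => (RCLike.abs_im_le_norm (g x)).trans (hK x)) him'
  have hQimI : ∀ f : Lp E 2 m, Q (himI.toLp _ • f) = himI.toLp _ • Q f := by
    intro f
    have heq : himI.toLp (fun x => ((RCLike.im (g x) : ℝ) : 𝕜) * RCLike.I) = (RCLike.I : 𝕜) • him'.toLp (fun x => ((RCLike.im (g x) : ℝ) : 𝕜)) := by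
      rw [← MemLp.toLp_const_smul]
      exact MemLp.toLp_congr _ _ (Eventually.of_forall fun x => by rw [Pi.smul_apply, smul_eq_mul, mul_comm])
    rw [heq]
    exact commute_lpSMul_const_smul Q _ hQim f
  have heq : h.toLp g = (hre'.add himI).toLp ((fun x => ((RCLike.re (g x) : ℝ) : 𝕜)) + fun x => ((RCLike.im (g x) : ℝ) : 𝕜) * RCLike.I) :=
    MemLp.toLp_congr _ _ (Eventually.of_forall fun x => by rw [Pi.add_apply, RCLike.re_add_im])
  rw [heq]
  exact commute_toLp_add Q hre' himI hQre hQimI f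

end Complex

end Summit.HodgeConjecture.HodgeConjecture.Cruxes.H413.K2E1CommutantOfMultiplicationFamilyBounded

end
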